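import Summits.ValiantsHypothesis.ValiantsHypothesis.Theorems.GrenetZeonDualUnipotentThreeHalvesLongMassSubmodule

/-!
# `GrenetZeon.DualUnipotentThreeHalves` (stmt-ValiantsHypothesis-24318), line `slow_core`, stub (c) `SlowCore.LongMassSlowLawInv`:
# RULES OF THE INTRINSIC (c)-PRICE — sub-spaces, conjugation, transpose (submodule currency)

Companion of ✓ `longMassSlowLawInv_iff_submodule` (`…LongMassSubmodule`) and ✓ `price_sup_of_commute` (`…LongMassCommutingSum`).  In the
coordinate-free currency a CERTIFICATE of `V ≤ M_b(ℂ)` at window `n` is `(W, k)`, `W ≤ V`, with the WINDOW property (every entry of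
`(A + s·w)^p`, `A ∈ V`, `w ∈ W`, `p ≤ n − 1`, of `s`-degree `≤ k`), PRICE `n·k + (dim V − dim W)`.  This file lands the three basic rules a seat
working intrinsically needs, so that no detour through pencils is required:

* ★ `price_mono_submodule` — SUB-SPACES ARE CHEAPER: `V' ≤ V` ⇒ a certificate `(W, k)` of `V` restricts to `(W ⊓ V', k)` of `V'` with
  `dim V' − dim (W ⊓ V') ≤ dim V − dim W` (the submodule form of ✓ `relCert_of_valueSpace_le`).
* ★ `price_conj_submodule` — CONJUGATION: `V ↦ g V g⁻¹` keeps every certificate (`(g M g⁻¹)^p = g M^p g⁻¹` over `ℂ[s]`, ✓ `FlagCost.conj_pow_eq`,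
  ✓ `FlagCost.totalDegree_conj_le`; dimensions are preserved).
* ★ `price_transpose_submodule` — TRANSPOSE: `V ↦ Vᵀ` keeps every certificate.

Honest framing.  Bookkeeping rules (`--supports stmt-ValiantsHypothesis-24318`), NOT progress on (c): (c) `SlowCore.LongMassSlowLawInv`, S3, the
crux 24318, 8062 and `VP ≠ VNP` remain OPEN / NOT proved.  No sorry, no definitions, no named facts.
-/

-- single-conjunct layout: Sub = Summit, duplicated namespace component intended (the name is mandated)
set_option linter.dupNamespace false
set_option autoImplicit false

noncomputable section

namespace Summit.ValiantsHypothesis.ValiantsHypothesis.Theorems.GrenetZeon.LongMassHomogenise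

open MvPolynomial Matrix
open scoped BigOperators
open Summit.ValiantsHypothesis.ValiantsHypothesis.Theorems.GrenetZeon.FlagCost (conj_pow_eq totalDegree_conj_le)

variable {b : ℕ}

/-! ## §1 Sub-spaces -/

/-- Codimension does not grow under intersection with a sub-space: `dim V' − dim (W ⊓ V') ≤ dim V − dim W` for `W ≤ V`, `V' ≤ V`. -/
theorem codim_inf_le (V V' W : Submodule ℂ (Matrix (Fin b) (Fin b) ℂ)) (hW : W ≤ V) (hV' : V' ≤ V) :
    Module.finrank ℂ V' - Module.finrank ℂ ↥(W ⊓ V') ≤ Module.finrank ℂ V - Module.finrank ℂ W := by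
  have hsum := Submodule.finrank_sup_add_finrank_inf_eq W V'
  have hsup : Module.finrank ℂ ↥(W ⊔ V') ≤ Module.finrank ℂ V := Submodule.finrank_mono (sup_le hW hV')
  have h1 : Module.finrank ℂ W ≤ Module.finrank ℂ V := Submodule.finrank_mono hW
  omega

/-- ★ **SUB-SPACES ARE CHEAPER** (submodule currency): a certificate of `V` of price `≤ P` restricts to one of every `V' ≤ V`. -/
theorem price_mono_submodule (V V' : Submodule ℂ (Matrix (Fin b) (Fin b) ℂ)) (hV' : V' ≤ V) {n P : ℕ}
    (h : ∃ (W : Submodule ℂ (Matrix (Fin b) (Fin b) ℂ)) (k : ℕ), W ≤ V ∧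
      (∀ A ∈ V, ∀ w ∈ W, ∀ p : ℕ, p ≤ n - 1 → ∀ i j : Fin b,
        ((((A.map (C : ℂ → MvPolynomial (Fin 1) ℂ) + (X 0 : MvPolynomial (Fin 1) ℂ) • w.map C) ^ p :
          Matrix (Fin b) (Fin b) (MvPolynomial (Fin 1) ℂ)) i j).totalDegree ≤ k)) ∧
      n * k + (Module.finrank ℂ V - Module.finrank ℂ W) ≤ P) :
    ∃ (W : Submodule ℂ (Matrix (Fin b) (Fin b) ℂ)) (k : ℕ), W ≤ V' ∧
      (∀ A ∈ V', ∀ w ∈ W, ∀ p : ℕ, p ≤ n - 1 → ∀ i j : Fin b,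
        ((((A.map (C : ℂ → MvPolynomial (Fin 1) ℂ) + (X 0 : MvPolynomial (Fin 1) ℂ) • w.map C) ^ p :
          Matrix (Fin b) (Fin b) (MvPolynomial (Fin 1) ℂ)) i j).totalDegree ≤ k)) ∧
      n * k + (Module.finrank ℂ V' - Module.finrank ℂ W) ≤ P := by
  obtain ⟨W, k, hW, hwin, hprice⟩ := h
  refine ⟨W ⊓ V', k, inf_le_right, fun A hA w hw p hp i j => hwin A (hV' hA) w (inf_le_left (a := W) hw) p hp i j, ?_⟩
  exact le_trans (Nat.add_le_add_left (codim_inf_le V V' W hW hV') _) hprice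

/-! ## §2 Conjugation -/

/-- Conjugating the line matrix: `(gAg')·C + s·(gwg')·C = G (A·C + s·w·C) G'` with `G = g·C`, `G' = g'·C`. -/
theorem lineMat_conj (g g' A w : Matrix (Fin b) (Fin b) ℂ) :
    ((g * A * g').map (C : ℂ → MvPolynomial (Fin 1) ℂ) + (X 0 : MvPolynomial (Fin 1) ℂ) • (g * w * g').map C) =
      g.map C * (A.map (C : ℂ → MvPolynomial (Fin 1) ℂ) + (X 0 : MvPolynomial (Fin 1) ℂ) • w.map C) * g'.map C := by
  have hmul : ∀ P Q : Matrix (Fin b) (Fin b) ℂ,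
      (P * Q).map (C : ℂ → MvPolynomial (Fin 1) ℂ) = P.map C * Q.map C := fun P Q =>
    Matrix.map_mul (f := (C : ℂ →+* MvPolynomial (Fin 1) ℂ))
  rw [hmul, hmul, hmul, hmul, Matrix.mul_add, Matrix.add_mul, Matrix.mul_smul, Matrix.smul_mul]

/-- ★ **CONJUGATION KEEPS CERTIFICATES** (submodule currency). -/
theorem price_conj_submodule (V : Submodule ℂ (Matrix (Fin b) (Fin b) ℂ)) (g g' : Matrix (Fin b) (Fin b) ℂ)
    (hgg : g' * g = 1) (hgg' : g * g' = 1) {n P : ℕ}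
    (h : ∃ (W : Submodule ℂ (Matrix (Fin b) (Fin b) ℂ)) (k : ℕ), W ≤ V ∧
      (∀ A ∈ V, ∀ w ∈ W, ∀ p : ℕ, p ≤ n - 1 → ∀ i j : Fin b,
        ((((A.map (C : ℂ → MvPolynomial (Fin 1) ℂ) + (X 0 : MvPolynomial (Fin 1) ℂ) • w.map C) ^ p :
          Matrix (Fin b) (Fin b) (MvPolynomial (Fin 1) ℂ)) i j).totalDegree ≤ k)) ∧
      n * k + (Module.finrank ℂ V - Module.finrank ℂ W) ≤ P) :
    ∃ (W : Submodule ℂ (Matrix (Fin b) (Fin b) ℂ)) (k : ℕ),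
      W ≤ V.map ((LinearMap.mulRight ℂ g').comp (LinearMap.mulLeft ℂ g)) ∧
      (∀ A ∈ V.map ((LinearMap.mulRight ℂ g').comp (LinearMap.mulLeft ℂ g)), ∀ w ∈ W, ∀ p : ℕ, p ≤ n - 1 → ∀ i j : Fin b,
        ((((A.map (C : ℂ → MvPolynomial (Fin 1) ℂ) + (X 0 : MvPolynomial (Fin 1) ℂ) • w.map C) ^ p :
          Matrix (Fin b) (Fin b) (MvPolynomial (Fin 1) ℂ)) i j).totalDegree ≤ k)) ∧
      n * k + (Module.finrank ℂ ↥(V.map ((LinearMap.mulRight ℂ g').comp (LinearMap.mulLeft ℂ g))) -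
        Module.finrank ℂ W) ≤ P := by
  obtain ⟨W, k, hW, hwin, hprice⟩ := h
  set φ : Matrix (Fin b) (Fin b) ℂ →ₗ[ℂ] Matrix (Fin b) (Fin b) ℂ := (LinearMap.mulRight ℂ g').comp (LinearMap.mulLeft ℂ g) with hφ
  have hφapp : ∀ M, φ M = g * M * g' := fun M => rfl
  have hφinj : Function.Injective φ := by
    intro M N hMN
    have h1 : g' * (g * M * g') * g = g' * (g * N * g') * g := by rw [← hφapp, ← hφapp, hMN]
    have key : ∀ M : Matrix (Fin b) (Fin b) ℂ, g' * (g * M * g') * g = M := fun M => by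
      rw [Matrix.mul_assoc g M g', ← Matrix.mul_assoc g' g, hgg, Matrix.one_mul, Matrix.mul_assoc, hgg, Matrix.mul_one]
    rwa [key, key] at h1
  have hdim : ∀ U : Submodule ℂ (Matrix (Fin b) (Fin b) ℂ), Module.finrank ℂ ↥(U.map φ) = Module.finrank ℂ U :=
    fun U => (LinearEquiv.finrank_eq (Submodule.equivMapOfInjective φ hφinj U)).symm
  refine ⟨W.map φ, k, Submodule.map_mono hW, ?_, by rw [hdim, hdim]; exact hprice⟩
  intro A' hA' w' hw' p hp i j
  obtain ⟨A, hA, rfl⟩ := Submodule.mem_map.mp hA'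
  obtain ⟨w, hw, rfl⟩ := Submodule.mem_map.mp hw'
  rw [hφapp, hφapp, lineMat_conj]
  set M := A.map (C : ℂ → MvPolynomial (Fin 1) ℂ) + (X 0 : MvPolynomial (Fin 1) ℂ) • w.map C with hM
  have hGG : g'.map (C : ℂ → MvPolynomial (Fin 1) ℂ) * g.map C = 1 := by
    rw [← Matrix.map_mul (f := (C : ℂ →+* MvPolynomial (Fin 1) ℂ)), hgg, Matrix.map_one C (map_zero C) (map_one C)]
  have hGG' : g.map (C : ℂ → MvPolynomial (Fin 1) ℂ) * g'.map C = 1 := by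
    rw [← Matrix.map_mul (f := (C : ℂ →+* MvPolynomial (Fin 1) ℂ)), hgg', Matrix.map_one C (map_zero C) (map_one C)]
  -- `(G M G')^p = G M^p G'`
  have hpow : (g.map (C : ℂ → MvPolynomial (Fin 1) ℂ) * M * g'.map C) ^ p = g.map C * M ^ p * g'.map C := by
    have h1 := conj_pow_eq (g.map (C : ℂ → MvPolynomial (Fin 1) ℂ)) (g'.map C) M hGG p
    rw [← h1]
    calc (g.map (C : ℂ → MvPolynomial (Fin 1) ℂ) * M * g'.map C) ^ p
        = (g.map (C : ℂ → MvPolynomial (Fin 1) ℂ) * g'.map C) * (g.map (C : ℂ → MvPolynomial (Fin 1) ℂ) * M * g'.map C) ^ p *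
            (g.map (C : ℂ → MvPolynomial (Fin 1) ℂ) * g'.map C) := by
          rw [hGG', Matrix.one_mul, Matrix.mul_one]
      _ = g.map C * (g'.map C * (g.map (C : ℂ → MvPolynomial (Fin 1) ℂ) * M * g'.map C) ^ p * g.map C) * g'.map C := by
          simp only [Matrix.mul_assoc]
  rw [hpow]
  exact totalDegree_conj_le g' g (M ^ p) (fun a c => hwin A hA w hw p hp a c) i j

/-! ## §3 Transpose -/

/-- ★ **TRANSPOSE KEEPS CERTIFICATES** (submodule currency). -/
theorem price_transpose_submodule (V : Submodule ℂ (Matrix (Fin b) (Fin b) ℂ)) {n P : ℕ}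
    (h : ∃ (W : Submodule ℂ (Matrix (Fin b) (Fin b) ℂ)) (k : ℕ), W ≤ V ∧
      (∀ A ∈ V, ∀ w ∈ W, ∀ p : ℕ, p ≤ n - 1 → ∀ i j : Fin b,
        ((((A.map (C : ℂ → MvPolynomial (Fin 1) ℂ) + (X 0 : MvPolynomial (Fin 1) ℂ) • w.map C) ^ p :
          Matrix (Fin b) (Fin b) (MvPolynomial (Fin 1) ℂ)) i j).totalDegree ≤ k)) ∧
      n * k + (Module.finrank ℂ V - Module.finrank ℂ W) ≤ P) :
    ∃ (W : Submodule ℂ (Matrix (Fin b) (Fin b) ℂ)) (k : ℕ),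
      W ≤ V.map (Matrix.transposeLinearEquiv (Fin b) (Fin b) ℂ ℂ).toLinearMap ∧
      (∀ A ∈ V.map (Matrix.transposeLinearEquiv (Fin b) (Fin b) ℂ ℂ).toLinearMap, ∀ w ∈ W, ∀ p : ℕ, p ≤ n - 1 →
        ∀ i j : Fin b,
        ((((A.map (C : ℂ → MvPolynomial (Fin 1) ℂ) + (X 0 : MvPolynomial (Fin 1) ℂ) • w.map C) ^ p :
          Matrix (Fin b) (Fin b) (MvPolynomial (Fin 1) ℂ)) i j).totalDegree ≤ k)) ∧
      n * k + (Module.finrank ℂ ↥(V.map (Matrix.transposeLinearEquiv (Fin b) (Fin b) ℂ ℂ).toLinearMap) -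
        Module.finrank ℂ W) ≤ P := by
  obtain ⟨W, k, hW, hwin, hprice⟩ := h
  set τ := (Matrix.transposeLinearEquiv (Fin b) (Fin b) ℂ ℂ).toLinearMap with hτ
  have hτapp : ∀ M : Matrix (Fin b) (Fin b) ℂ, τ M = M.transpose := fun M => rfl
  have hdim : ∀ U : Submodule ℂ (Matrix (Fin b) (Fin b) ℂ), Module.finrank ℂ ↥(U.map τ) = Module.finrank ℂ U :=
    fun U => (LinearEquiv.finrank_eq
      (Submodule.equivMapOfInjective τ (Matrix.transposeLinearEquiv (Fin b) (Fin b) ℂ ℂ).injective U)).symm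
  refine ⟨W.map τ, k, Submodule.map_mono hW, ?_, by rw [hdim, hdim]; exact hprice⟩
  intro A' hA' w' hw' p hp i j
  obtain ⟨A, hA, rfl⟩ := Submodule.mem_map.mp hA'
  obtain ⟨w, hw, rfl⟩ := Submodule.mem_map.mp hw'
  rw [hτapp, hτapp]
  have hT : (A.transpose.map (C : ℂ → MvPolynomial (Fin 1) ℂ) + (X 0 : MvPolynomial (Fin 1) ℂ) • w.transpose.map C) =
      (A.map (C : ℂ → MvPolynomial (Fin 1) ℂ) + (X 0 : MvPolynomial (Fin 1) ℂ) • w.map C).transpose := by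
    rw [Matrix.transpose_add, Matrix.transpose_smul, Matrix.transpose_map, Matrix.transpose_map]
  rw [hT, ← Matrix.transpose_pow, Matrix.transpose_apply]
  exact hwin A hA w hw p hp j i

end Summit.ValiantsHypothesis.ValiantsHypothesis.Theorems.GrenetZeon.LongMassHomogenise

end
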